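import Summits.QuantumAdvantage.QuantumAdvantage.Theorems.CubicForrelationNearExactIsExactCubicFormR4ZLeafInv
import Summits.QuantumAdvantage.QuantumAdvantage.Theorems.CubicForrelationNearExactIsExactTwelvePartnerRadical

/-!
# Crux `CubicForrelation.NearExactIsExact` (stmt-QuantumAdvantage-14043) — E1280-even, R4 branch, the d-level leaf of descendant `0`:
  the radical ranks `rank Ξ ≤ 2` (a KERNEL VECTOR)

Certificate seat `b2b-cforr-cert` (gen 43).  HONEST FRAMING: kernel-checked linear algebra over `𝔽₂` (standard axioms).  `tq5_leaf_ker`: in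
the data of the leaf statement `HLEAF` of …CubicFormR4ZReduce, if the `z`-coordinates `R` (…CubicFormR4ZLeafXi) have at least `7 − k ≥ 5`
radical columns (`k ≤ 2`, i.e. `rank Ξ ≤ 2`), then a non-zero `(w, μ)` with `M_t·r = a_t μ`, `E·r = 0` for `r = R w` supported on the
radical columns exists by …CubicFormR4ZLeafInv `tq5_kernel_pigeon` (`8 − k` unknowns, `5` conditions... together with `w_s = 0` for `s < k`:
seven conditions on eight unknowns); then `z_r` is a kernel vector of `d` (`d(z_r,v_t,v_t') = ω E·r + a_t a_t' μ + a_t' a_t μ = 0`,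
`d(z_r,v_t,z) = a_t Ξ r = 0`, `d(z_r,z,z) = 0`, `d(z_r,y,·) = 0`), so `r = 0` by `tpr_radical_obstruction` (…TwelvePartnerRadical), whence
`w = 0`, `μ = 1` and `a = 0` — contradicting `a ≠ 0`.  Nothing about `θ₁₂` by itself; NOT summit progress.

References: this seat lineage (g39 HANDPROOFS §2.4 "(★)", g43 LEAN-GEN43).  Axioms: the standard three.
-/

set_option linter.dupNamespace false -- D-0017: single-problem summit ⇒ `QuantumAdvantage.QuantumAdvantage` by design

namespace Summit.QuantumAdvantage.QuantumAdvantage.Theorems.CubicForrelation.NearExactIsExact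

open Finset

/-- **The leaf for `rank Ξ ≤ 2`.**  See the module docstring. [this work] -/
theorem tq5_leaf_ker (c d : Fin (5 + 7) → Fin (5 + 7) → Fin (5 + 7) → ZMod 2)
    (hds : ∀ φ j k, d φ k j = d φ j k) (hdc : ∀ φ j k, d j φ k = d φ j k)
    (hpair : ∀ p φ, (∑ j, ∑ k, (if j < k then c p j k * d φ j k else 0)) = if p = φ then 1 else 0)
    (hF : ∀ j k, d (Fin.castAdd 7 (0 : Fin 5)) j k =
      (if (j = Fin.castAdd 7 (1 : Fin 5) ∧ k = Fin.castAdd 7 (2 : Fin 5)) ∨ (j = Fin.castAdd 7 (2 : Fin 5) ∧ k = Fin.castAdd 7 (1 : Fin 5)) then 1 else 0) +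
      (if (j = Fin.castAdd 7 (3 : Fin 5) ∧ k = Fin.castAdd 7 (4 : Fin 5)) ∨ (j = Fin.castAdd 7 (4 : Fin 5) ∧ k = Fin.castAdd 7 (3 : Fin 5)) then 1 else 0))
    (hzzz : ∀ σ τ υ : Fin 7, d (Fin.natAdd 5 σ) (Fin.natAdd 5 τ) (Fin.natAdd 5 υ) = 0) (a : Fin 4 → ZMod 2) (ha : ∃ t, a t = 1) (Ξ : Fin 7 → Fin 7 → ZMod 2) (hΞs : ∀ j k, Ξ k j = Ξ j k)
    (hdΞ : ∀ (t : Fin 4) (j k : Fin 7), d (Fin.castAdd 7 t.succ) (Fin.natAdd 5 j) (Fin.natAdd 5 k) = a t * Ξ j k)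
    (E : Fin 7 → ZMod 2) (M : Fin 4 → Fin 7 → ZMod 2)
    (hdL : ∀ (t t' : Fin 4) (j : Fin 7), d (Fin.castAdd 7 t.succ) (Fin.castAdd 7 t'.succ) (Fin.natAdd 5 j) =
      ((if (t = 0 ∧ t' = 1) ∨ (t = 1 ∧ t' = 0) then (1 : ZMod 2) else 0) + (if (t = 2 ∧ t' = 3) ∨ (t = 3 ∧ t' = 2) then (1 : ZMod 2) else 0)) * E j + a t * M t' j + a t' * M t j)
    (R Ri : Fin 7 → Fin 7 → ZMod 2) (hRRi : ∀ j k, (∑ s, R j s * Ri s k) = if j = k then 1 else 0)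
    (hRiR : ∀ j k, (∑ s, Ri j s * R s k) = if j = k then 1 else 0)
    (k : ℕ) (hk : k ≤ 2) (hrad : ∀ s : Fin 7, k ≤ s.val → ∀ u : Fin 7, (∑ m, ∑ m', Ξ m m' * R m s * R m' u) = 0) : False := by
  classical
  obtain ⟨w, μ, hne, hM, hE, hw0⟩ := tq5_kernel_pigeon (fun t s => ∑ j, M t j * R j s) a (fun s => ∑ j, E j * R j s) k hk
  obtain ⟨r, hr⟩ : ∃ r : Fin 7 → ZMod 2, ∀ m, r m = ∑ s, R m s * w s := ⟨_, fun _ => rfl⟩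
  -- pairings of `r`
  have hlin : ∀ f : Fin 7 → ZMod 2, (∑ m, f m * r m) = ∑ s, (∑ j, f j * R j s) * w s := by
    intro f
    simp only [hr, Finset.mul_sum]
    rw [Finset.sum_comm]
    refine sum_congr rfl fun s _ => ?_
    rw [Finset.sum_mul]
    exact sum_congr rfl fun m _ => by ring
  have hEr : (∑ m, E m * r m) = 0 := by rw [hlin, hE]
  have hMr : ∀ t, (∑ m, M t m * r m) = a t * μ := fun t => by rw [hlin, hM t]
  -- `r` is a radical vector of `Ξ`
  have hcol : ∀ s : Fin 7, k ≤ s.val → ∀ k', (∑ m, Ξ k' m * R m s) = 0 := by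
    intro s hs k'
    have hX : ∀ u, (∑ m', (∑ m, Ξ m m' * R m s) * R m' u) = 0 := by
      intro u
      have e := hrad s hs u
      rw [Finset.sum_comm] at e
      refine Eq.trans (sum_congr rfl fun m' _ => ?_) e
      rw [Finset.sum_mul]
    calc (∑ m, Ξ k' m * R m s) = ∑ m, Ξ m k' * R m s := sum_congr rfl fun m _ => by rw [hΞs k' m]
      _ = ∑ m', (∑ m, Ξ m m' * R m s) * (∑ u, R m' u * Ri u k') := by
          simp only [hRRi, mul_ite, mul_one, mul_zero, Finset.sum_ite_eq', Finset.mem_univ, if_true]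
      _ = ∑ u, (∑ m', (∑ m, Ξ m m' * R m s) * R m' u) * Ri u k' := by
          simp only [Finset.mul_sum, Finset.sum_mul]
          rw [Finset.sum_comm]
          exact sum_congr rfl fun u _ => sum_congr rfl fun m' _ => sum_congr rfl fun x _ => by ring
      _ = 0 := Finset.sum_eq_zero fun u _ => by rw [hX u, zero_mul]
  have hΞr : ∀ k', (∑ m, Ξ k' m * r m) = 0 := by
    intro k'
    rw [hlin]
    refine Finset.sum_eq_zero fun s _ => ?_
    by_cases hs : k ≤ s.val
    · rw [hcol s hs k', zero_mul]
    · rw [hw0 s (by omega), mul_zero]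
  -- the kernel vector `z_r`
  have hz : ∀ j : Fin 7, (Fin.natAdd 5 j : Fin (5 + 7)) ≠ 1 ∧ (Fin.natAdd 5 j : Fin (5 + 7)) ≠ 2 ∧ (Fin.natAdd 5 j : Fin (5 + 7)) ≠ 3 ∧
      (Fin.natAdd 5 j : Fin (5 + 7)) ≠ 4 := by decide
  have hzy : ∀ (m : Fin 7) (x : Fin (5 + 7)), d (Fin.natAdd 5 m) (Fin.castAdd 7 (0 : Fin 5)) x = 0 := fun m x => by rw [hdc, hF]; simp [hz]
  have hzxy : ∀ (m : Fin 7) (x : Fin (5 + 7)), d (Fin.natAdd 5 m) x (Fin.castAdd 7 (0 : Fin 5)) = 0 := fun m x => by rw [hds]; exact hzy m x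
  have h2 : ∀ x : ZMod 2, x + x = 0 := by decide
  obtain ⟨u, hu0, huz⟩ : ∃ u : Fin (5 + 7) → ZMod 2, (∀ a₁ : Fin 5, u (Fin.castAdd 7 a₁) = 0) ∧ (∀ m : Fin 7, u (Fin.natAdd 5 m) = r m) :=
    ⟨Fin.append 0 r, fun a₁ => by simp, fun m => by simp⟩
  have hu : ∀ j k₁, (∑ φ, u φ * d φ j k₁) = 0 := by
    intro j k₁
    rw [tq5_split]
    simp only [hu0, huz, zero_mul, sum_const_zero, zero_add]
    induction j using Fin.addCases with
    | left a₁ =>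
      induction a₁ using Fin.cases with
      | zero => exact Finset.sum_eq_zero fun m _ => by rw [hzy, mul_zero]
      | succ t =>
        induction k₁ using Fin.addCases with
        | left b₁ =>
          induction b₁ using Fin.cases with
          | zero => exact Finset.sum_eq_zero fun m _ => by rw [hzxy, mul_zero]
          | succ t' =>
            have e : ∀ m : Fin 7, d (Fin.natAdd 5 m) (Fin.castAdd 7 (Fin.succ t)) (Fin.castAdd 7 (Fin.succ t')) = (((if (t = 0 ∧ t' = 1) ∨ (t = 1 ∧ t' = 0) then (1 : ZMod 2) else 0) + (if (t = 2 ∧ t' = 3) ∨ (t = 3 ∧ t' = 2) then (1 : ZMod 2) else 0)) * E m + a t * M t' m + a t' * M t m) := fun m => by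
              rw [hdc, hds, hdL]
            have f1 : (∑ m, r m * (((if (t = 0 ∧ t' = 1) ∨ (t = 1 ∧ t' = 0) then (1 : ZMod 2) else 0) + (if (t = 2 ∧ t' = 3) ∨ (t = 3 ∧ t' = 2) then (1 : ZMod 2) else 0)) * E m + a t * M t' m + a t' * M t m)) =
                ((if (t = 0 ∧ t' = 1) ∨ (t = 1 ∧ t' = 0) then (1 : ZMod 2) else 0) + (if (t = 2 ∧ t' = 3) ∨ (t = 3 ∧ t' = 2) then (1 : ZMod 2) else 0)) * (∑ m, E m * r m) + a t * (∑ m, M t' m * r m) + a t' * (∑ m, M t m * r m) := by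
              simp only [Finset.mul_sum, ← sum_add_distrib]
              exact sum_congr rfl fun m _ => by ring
            simp only [e]
            rw [f1, hEr, hMr, hMr, mul_zero, zero_add]
            rw [show a t' * (a t * μ) = a t * (a t' * μ) by ring]
            exact h2 _
        | right k' =>
          have e : ∀ m : Fin 7, d (Fin.natAdd 5 m) (Fin.castAdd 7 (Fin.succ t)) (Fin.natAdd 5 k') = a t * Ξ m k' := fun m => by rw [hdc, hdΞ]
          have f1 : (∑ m, r m * (a t * Ξ m k')) = a t * ∑ m, Ξ k' m * r m := by
            rw [Finset.mul_sum]
            exact sum_congr rfl fun m _ => by rw [hΞs k' m]; ring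
          simp only [e]
          rw [f1, hΞr, mul_zero]
    | right j' =>
      induction k₁ using Fin.addCases with
      | left b₁ =>
        induction b₁ using Fin.cases with
        | zero => exact Finset.sum_eq_zero fun m _ => by rw [hzxy, mul_zero]
        | succ t' =>
          have e : ∀ m : Fin 7, d (Fin.natAdd 5 m) (Fin.natAdd 5 j') (Fin.castAdd 7 (Fin.succ t')) = a t' * Ξ m j' := fun m => by rw [hds, hdc, hdΞ]
          have f1 : (∑ m, r m * (a t' * Ξ m j')) = a t' * ∑ m, Ξ j' m * r m := by
            rw [Finset.mul_sum]
            exact sum_congr rfl fun m _ => by rw [hΞs j' m]; ring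
          simp only [e]
          rw [f1, hΞr, mul_zero]
      | right k' => exact Finset.sum_eq_zero fun m _ => by rw [hzzz, mul_zero]
  -- `r = 0`, `w = 0`, `μ = 1`, `a = 0`
  have hu' := tpr_radical_obstruction c d hpair u hu
  have hr0 : ∀ m, r m = 0 := fun m => by rw [← huz m, hu']; rfl
  have hw : ∀ s, w s = 0 := by
    intro s
    have e : w s = ∑ m, Ri s m * r m := by
      simp only [hr, Finset.mul_sum]
      rw [Finset.sum_comm]
      have e1 : ∀ s', (∑ m, Ri s m * (R m s' * w s')) = (if s = s' then 1 else 0) * w s' := fun s' => by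
        rw [← hRiR s s', Finset.sum_mul]
        exact sum_congr rfl fun m _ => by ring
      simp only [e1, ite_mul, one_mul, zero_mul, Finset.sum_ite_eq, Finset.mem_univ, if_true]
    rw [e]
    exact Finset.sum_eq_zero fun m _ => by rw [hr0 m, mul_zero]
  have hμ : μ ≠ 0 := hne.resolve_left fun h => h (funext fun s => hw s)
  have hμ1 : μ = 1 := by
    have key : ∀ x : ZMod 2, x ≠ 0 → x = 1 := by decide
    exact key μ hμ
  obtain ⟨t, ht⟩ := ha
  have e := hMr t
  rw [hμ1, mul_one, Finset.sum_eq_zero fun m _ => by rw [hr0 m, mul_zero]] at e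
  rw [← e] at ht
  exact zero_ne_one ht

end Summit.QuantumAdvantage.QuantumAdvantage.Theorems.CubicForrelation.NearExactIsExact
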